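import Summits.PneNP.PneNP.Theses.SymmetryBudget
import Literature.Computability.Complexity.SymmetricCircuit
import Literature.ModelTheory.FiniteModelTheory.CapturingPTIME
import Literature.ModelTheory.FiniteModelTheory.CkEquiv
import Literature.ModelTheory.FiniteModelTheory.CFI

/-!
# Crux-ideate sketch — WindowBarrier (stmt-PneNP-2145), ideator 1, round 1

First lemmas of the three idea cards (statements only, sorry-free `def … : Prop`):

* shared plumbing: `FreeCoreHard`, `FreeCoreToWindow` (restrict to the free part), `CFIWindowCheap`;
* card `young-block-support-game`: `WindowSupportTheorem`, `BlockSupports`;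
* card `subset-canonisation-dichotomy`: `WindowCanonisation`, `SlicesHavePolyCircuits`,
  `CanonisationKillsBarrier`, `mark`, `SubsetDiscretisation`, `markSet`, `MonadicRung`;
* card `bijection-gauge-twin-iso`: `twinIsoFn`, `TwinIsoHard`, `TwinIsoInP`, `TwinIsoToWindow`,
  `halvesGroup`, `pairInput`, `PairFooling`, `PairFoolingToTwinIsoHard`.
-/

noncomputable section

open Classical Filter
open Literature.Computability.Complexity Literature.ModelTheory.FiniteModelTheory

namespace Summit.PneNP.PneNP.Cruxes.WindowBarrier.IdeaSketch

/-- The route's reading of a Boolean matrix as a simple graph. -/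
def Gr (m : ℕ) (x : Fin m × Fin m → Bool) : SimpleGraph (Fin m) :=
  SimpleGraph.fromRel fun u v => x (u, v) = true

/-! ### Shared plumbing: the free core -/

/-- `Q` (an isomorphism-closed class of finite graphs) has FULLY symmetric threshold-circuit
complexity that is not `2^{O(n)}`: for every `c`, infinitely often no `Sym(Fin n)`-symmetric
`tcBasis` circuit of size `≤ 2^{c n}` decides membership of `n`-vertex graphs in `Q`. -/
def FreeCoreHard (Q : Set FinGraph) : Prop :=
  ∀ c : ℕ, ∃ᶠ n in atTop,
    ¬ HasSymCircuit tcBasis (Set.univ : Set (Equiv.Perm (Fin n))) (2 ^ (c * n))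
        (fun x : Fin n × Fin n → Bool => decide ((⟨n, Gr n x⟩ : FinGraph) ∈ Q))

/-- RestrictToFree: a polynomial-time, isomorphism-closed graph class whose fully symmetric
complexity is not `2^{O(n)}` yields `WindowBarrier` (plant `Q` on the free part `g = ⌊log₂ m⌋`,
ordered part empty; a `Bud(m,g)`-symmetric circuit of size `p(m) ≤ p(2^{g+1})` restricts to a
`Sym(g)`-symmetric circuit for `Q`). Provable now (the only real work is `L ∈ P`). -/
def FreeCoreToWindow : Prop :=
  ∀ Q : Set FinGraph, IsIsoClosed Q → IsPTIMEClass Q → FreeCoreHard Q →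
    Summit.PneNP.PneNP.Theses.SymmetryBudget.WindowBarrier

/-- **Materialisation tax, CFI instance** (why dimension-one gauges die in the window): over a
FIXED connected base graph `G`, "the input is an even CFI graph over `G`" has fully symmetric
threshold circuits of size `2^{O(N)}` (guess a section as a vertex SUBSET — orbit `≤ 2^N` — and
check it locally; OR over subsets). Provable now; calibrates every candidate witness. -/
def CFIWindowCheap : Prop :=
  ∃ c : ℕ, ∀ (v : ℕ) (G : SimpleGraph (Fin v)), G.Connected →
    ∀ N : ℕ, HasSymCircuit tcBasis (Set.univ : Set (Equiv.Perm (Fin N))) (2 ^ (c * N))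
      (fun x => decide (IsEvenCFIOf G (⟨N, Gr N x⟩ : FinGraph)))

/-! ### Card A — window support theorem (orbit ENTROPY replaces support SIZE) -/

/-- **Window support theorem** (structure of subgroups of `Sym(n)` of index `≤ 2^{c n}`): such a
subgroup contains the product of the alternating groups of pairwise disjoint blocks `B i` which
cover all but `O(c · n / log n)` points and have bounded entropy `∑ |B i| log (n/|B i|) = O(c n)`.
(Dixon–Mortimer Thm 5.2B is the case "index `< C(n,k)`, one block of size `> n - k`".) -/
def WindowSupportTheorem : Prop :=
  ∀ c : ℕ, ∃ K : ℕ, ∀ n : ℕ, ∀ G : Subgroup (Equiv.Perm (Fin n)),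
    G.index ≤ 2 ^ (c * n) →
      ∃ (r : ℕ) (B : Fin r → Finset (Fin n)),
        (∀ i j, i ≠ j → Disjoint (B i) (B j)) ∧
        (∀ i, ∀ σ : Equiv.Perm (Fin n),
            (∀ x, x ∉ B i → σ x = x) → Equiv.Perm.sign σ = 1 → σ ∈ G) ∧
        (n - ∑ i, (B i).card) * Nat.log 2 n ≤ K * n ∧
        ∑ i, (B i).card * Nat.log 2 (n / (B i).card) ≤ K * n

/-- **Block supports** (the circuit-facing corollary): in a fully symmetric threshold circuit of
size `≤ 2^{c n}` every gate is stabilised (in the sense of `Circuit.gateStabiliser`) by all even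
permutations supported inside each block of a low-entropy block family. Follows from
`WindowSupportTheorem` because the stabiliser of a gate has index at most the number of gates. -/
def BlockSupports : Prop :=
  ∀ c : ℕ, ∃ K : ℕ, ∀ n : ℕ, ∀ C : Circuit (Fin n × Fin n),
    C.IsOver tcBasis → C.IsSymmetricUnder (Set.univ : Set (Equiv.Perm (Fin n))) →
      C.size ≤ 2 ^ (c * n) →
        ∀ j : Fin C.gates.length, ∃ (r : ℕ) (B : Fin r → Finset (Fin n)),
          (∀ i i', i ≠ i' → Disjoint (B i) (B i')) ∧
          (n - ∑ i, (B i).card) * Nat.log 2 n ≤ K * n ∧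
          ∑ i, (B i).card * Nat.log 2 (n / (B i).card) ≤ K * n ∧
          ∀ i, ∀ σ : Equiv.Perm (Fin n), (∀ x, x ∉ B i → σ x = x) → Equiv.Perm.sign σ = 1 →
            σ ∈ C.gateStabiliser (Set.univ : Set (Equiv.Perm (Fin n))) j

/-! ### Card B — subset-individualisation canonisation dichotomy -/

/-- **Symmetric canonisation in the window**: a `Bud(m,⌊log₂ m⌋)`-equivariant canonical
relabelling `κ x = x ∘ (π_x × π_x)` (`π_x ∈ Bud`), `Bud`-invariant as a function of `x`, every
output bit of which has a polynomial-size `Bud`-symmetric threshold circuit. -/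
def WindowCanonisation : Prop :=
  ∃ p : Polynomial ℕ, ∀ m : ℕ, ∃ κ : (Fin m × Fin m → Bool) → (Fin m × Fin m → Bool),
    (∀ x, ∃ π ∈ pointStabiliserBudget m (Nat.log 2 m), κ x = fun q => x (π q.1, π q.2)) ∧
    (∀ x, ∀ ρ ∈ pointStabiliserBudget m (Nat.log 2 m),
        κ (fun q => x (ρ q.1, ρ q.2)) = κ x) ∧
    ∀ q : Fin m × Fin m,
      HasSymCircuit tcBasis (pointStabiliserBudget m (Nat.log 2 m)) (p.eval m) (fun x => κ x q)

/-- Graph slices of polynomial-time languages have polynomial-size (ordinary) threshold circuits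
(`P ⊆ P/poly` composed with the trivial circuit for `x ↦ encode ⟨m, Gr x⟩`). -/
def SlicesHavePolyCircuits : Prop :=
  ∀ L ∈ Classes.P, ∃ p : Polynomial ℕ, ∀ m : ℕ, ∃ C : Circuit (Fin m × Fin m),
    C.IsOver tcBasis ∧ C.size ≤ p.eval m ∧
      C.Computes (fun x => decide (encodingGraph.encode (⟨m, Gr m x⟩ : FinGraph) ∈ L))

/-- **The refutation edge of the dichotomy**: symmetric canonisation in the window kills the
barrier (compose the canonising blocks, whose outputs are fixed by the automorphisms, with an
ordinary slice circuit on the canonical copy). Contrapositive: `WindowBarrier → ¬ WindowCanonisation`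
— canonical-form bits are the universal hard function. -/
def CanonisationKillsBarrier : Prop :=
  WindowCanonisation → SlicesHavePolyCircuits →
    ¬ Summit.PneNP.PneNP.Theses.SymmetryBudget.WindowBarrier

/-- Marking gadget: `mark G S u` is `G` on `Fin n` together with an apex `n` joined to `S` and to
`n + 1` pendant leaves, and an apex `2n + 2` joined to `u` and to `2n + 5` pendant leaves (so that
plain `C^k`-equivalence of the marked graphs expresses `C^k`-equivalence of `(G, S, u)`). -/
def mark {n : ℕ} (G : SimpleGraph (Fin n)) (S : Finset (Fin n)) (u : Fin n) :
    SimpleGraph (Fin (4 * n + 8)) :=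
  SimpleGraph.fromRel fun a b =>
    (∃ (ha : (a : ℕ) < n) (hb : (b : ℕ) < n), G.Adj ⟨a, ha⟩ ⟨b, hb⟩) ∨
    ((a : ℕ) = n ∧ ∃ hb : (b : ℕ) < n, (⟨b, hb⟩ : Fin n) ∈ S) ∨
    ((a : ℕ) = n ∧ n < (b : ℕ) ∧ (b : ℕ) ≤ 2 * n + 1) ∨
    ((a : ℕ) = 2 * n + 2 ∧ (b : ℕ) = (u : ℕ)) ∨
    ((a : ℕ) = 2 * n + 2 ∧ 2 * n + 2 < (b : ℕ))

/-- **Subset Discretisation Conjecture (SIC, rigid form)** — the cheapest falsifier of the whole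
crux: some fixed `k` such that every asymmetric graph has a vertex subset `S` whose set-wise
individualisation makes `k`-variable counting logic discrete (all vertices pairwise
`C^k`-distinguishable in `(G, S)`). With the counting-canonisable residue for symmetric graphs it
gives `WindowCanonisation`, hence `¬ WindowBarrier`. Its NEGATION (robust, for P-separable families)
is what every witness for `WindowBarrier` must supply. -/
def SubsetDiscretisation : Prop :=
  ∃ k : ℕ, ∀ n : ℕ, ∀ G : SimpleGraph (Fin n), (∀ e : G ≃g G, ∀ v, e v = v) →
    ∃ S : Finset (Fin n), ∀ u v : Fin n, u ≠ v → ¬ CkEquiv k (mark G S u) (mark G S v)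

/-- Set-marking gadget (no individualised vertex): apex `n` joined to `S` and to `n + 1` leaves. -/
def markSet {n : ℕ} (G : SimpleGraph (Fin n)) (S : Finset (Fin n)) : SimpleGraph (Fin (2 * n + 2)) :=
  SimpleGraph.fromRel fun a b =>
    (∃ (ha : (a : ℕ) < n) (hb : (b : ℕ) < n), G.Adj ⟨a, ha⟩ ⟨b, hb⟩) ∨
    ((a : ℕ) = n ∧ ∃ hb : (b : ℕ) < n, (⟨b, hb⟩ : Fin n) ∈ S) ∨
    ((a : ℕ) = n ∧ n < (b : ℕ))

/-- **The first rung** (necessary for `WindowBarrier` at exponent `c ≈ 1`, strictly beyond CFI):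
a polynomial-time isomorphism-closed class separating, for every `k` and infinitely many `n`,
two `n`-vertex graphs between which Duplicator survives ONE bijective set-move followed by the
bijective `k`-pebble game — no single monadic guess plus `C^k` tells them apart. -/
def MonadicRung : Prop :=
  ∃ Q : Set FinGraph, IsIsoClosed Q ∧ IsPTIMEClass Q ∧ ∀ k : ℕ, ∃ᶠ n in atTop,
    ∃ A B : SimpleGraph (Fin n), (⟨n, A⟩ : FinGraph) ∈ Q ∧ (⟨n, B⟩ : FinGraph) ∉ Q ∧
      ∃ F : Finset (Fin n) ≃ Finset (Fin n), ∀ S : Finset (Fin n),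
        CkEquiv k (markSet A S) (markSet B (F S))

/-! ### Card C — hidden bijection (growing non-abelian gauge): twin isomorphism -/

/-- Twin isomorphism of the two marked halves of the free part: free vertices (the last
`⌊log₂ m⌋`) adjacent to the ordered vertex `0`, versus the other free vertices. `Bud`-invariant. -/
def twinIsoFn (m : ℕ) (x : Fin m × Fin m → Bool) : Bool :=
  let G : SimpleGraph (Fin m) := Gr m x
  let A : Set (Fin m) := {u | m ≤ (u : ℕ) + Nat.log 2 m ∧ ∃ h : 0 < m, G.Adj ⟨0, h⟩ u}
  let B : Set (Fin m) := {u | m ≤ (u : ℕ) + Nat.log 2 m ∧ ¬ ∃ h : 0 < m, G.Adj ⟨0, h⟩ u}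
  decide (Nonempty (G.induce A ≃g G.induce B))

/-- **TwinIsoHard** (the crux stub of card C): twin isomorphism has no polynomial-size
`Bud(m,⌊log₂ m⌋)`-symmetric threshold circuits, infinitely often, for every polynomial. -/
def TwinIsoHard : Prop :=
  ∀ p : Polynomial ℕ, ∃ᶠ m in atTop,
    ¬ HasSymCircuit tcBasis (pointStabiliserBudget m (Nat.log 2 m)) (p.eval m) (twinIsoFn m)

/-- Twin isomorphism is polynomial time (graph isomorphism on `⌊log₂ m⌋/2`-vertex halves in time
`2^{O(√(g log g))} = m^{o(1)}`: Babai–Luks 1983 canonical labelling, or Babai 2016; a FACT-level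
item, not provable by brute force — `(g/2)!` is superpolynomial in `m`). -/
def TwinIsoInP : Prop :=
  ∃ L ∈ Classes.P, ∀ (m : ℕ) (x : Fin m × Fin m → Bool),
    encodingGraph.encode (⟨m, Gr m x⟩ : FinGraph) ∈ L ↔ twinIsoFn m x = true

/-- **Card C's first lemma**: twin-isomorphism hardness gives the barrier (take `L` from
`TwinIsoInP`; its slices are `Bud`-invariant because `ρ ∈ Bud` fixes `0` and permutes the free
vertices, inducing isomorphisms of the halves). Provable now. -/
def TwinIsoToWindow : Prop :=
  TwinIsoInP → TwinIsoHard → Summit.PneNP.PneNP.Theses.SymmetryBudget.WindowBarrier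

/-- The Young subgroup `Sym(first h) × Sym(last h)` of `Sym(Fin (2h))` (the gauge of a hidden
bijection between two halves). -/
def halvesGroup (h : ℕ) : Set (Equiv.Perm (Fin (2 * h))) :=
  {ρ | ∀ i : Fin (2 * h), ((i : ℕ) < h ↔ ((ρ i : Fin (2 * h)) : ℕ) < h)}

/-- The pair input: `H₁` on the first `h` vertices, `H₂` on the last `h`, no edges across. -/
def pairInput {h : ℕ} (H₁ H₂ : SimpleGraph (Fin h)) : Fin (2 * h) × Fin (2 * h) → Bool :=
  fun q => decide
    ((∃ (h₁ : (q.1 : ℕ) < h) (h₂ : (q.2 : ℕ) < h), H₁.Adj ⟨q.1, h₁⟩ ⟨q.2, h₂⟩) ∨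
     (∃ (h₁ : h ≤ (q.1 : ℕ)) (h₂ : h ≤ (q.2 : ℕ)),
        H₂.Adj ⟨(q.1 : ℕ) - h, by omega⟩ ⟨(q.2 : ℕ) - h, by omega⟩))

/-- **PairFooling** (card C's Transfer target `C⁺`, purely combinatorial — no complexity
constraint on the fooling pair): for every exponent `c`, infinitely often there are
non-isomorphic `h`-vertex graphs `H₁, H₂` such that EVERY `Sym(h) × Sym(h)`-symmetric threshold
circuit of size `≤ 2^{c h}` on pairs takes the same value on `(H₁, H₁)` and `(H₁, H₂)`. -/
def PairFooling : Prop :=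
  ∀ c : ℕ, ∃ᶠ h in atTop, ∃ H₁ H₂ : SimpleGraph (Fin h), IsEmpty (H₁ ≃g H₂) ∧
    ∀ C : Circuit (Fin (2 * h) × Fin (2 * h)), C.IsOver tcBasis → C.size ≤ 2 ^ (c * h) →
      C.IsSymmetricUnder (halvesGroup h) → C.eval (pairInput H₁ H₁) = C.eval (pairInput H₁ H₂)

/-- `PairFooling → TwinIsoHard` (embed the `2h`-board as the two marked halves of the free part of
`m = 2^{2h}`; a `Bud`-symmetric circuit with the other inputs fixed to constants restricts to a
`halvesGroup`-symmetric one of the same size; `p(m) ≤ 2^{c h}` for `c` depending on `deg p`).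
Provable now. Together with `TwinIsoToWindow`: `TwinIsoInP → PairFooling → WindowBarrier`. -/
def PairFoolingToTwinIsoHard : Prop := PairFooling → TwinIsoHard

end Summit.PneNP.PneNP.Cruxes.WindowBarrier.IdeaSketch

end
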